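import Mathlib.RingTheory.TensorProduct.Maps
import Mathlib.LinearAlgebra.TensorProduct.RightExactness
import Mathlib.RingTheory.Ideal.Quotient.Operations
import Mathlib.RingTheory.MvPolynomial.Basic
import Mathlib.Algebra.MvPolynomial.CommRing
import Literature.NumberTheory.Transcendental.MZVWordShuffle
import HarnessLib

/-!
# Goncharov's Hopf algebra `𝓘_•(S)` of formal iterated integrals

A. B. Goncharov, *Galois symmetries of fundamental groupoids and noncommutative geometry*, Duke
Math. J. **128** (2005), §2.1 [Goncharov2005]. For a set `S`, `𝓘_•(S)` is the commutative
`ℚ`-algebra generated by symbols `𝕀(s₀; s₁, …, s_m; s_{m+1})`, `sᵢ ∈ S`, `m ≥ 0` (homogeneous of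
degree `m`), subject to (verbatim from §2.1):

* (i) *unit*: `𝕀(a; ∅; b) = 1`;
* (ii) *shuffle product formula*:
  `𝕀(a; s₁…s_m; b) · 𝕀(a; s_{m+1}…s_{m+n}; b) = Σ_{σ ∈ Σ_{m,n}} 𝕀(a; s_{σ(1)}…s_{σ(m+n)}; b)`;
* (iii) *path composition formula*: for every `x ∈ S`,
  `𝕀(s₀; s₁…s_m; s_{m+1}) = Σ_{k=0}^{m} 𝕀(s₀; s₁…s_k; x) · 𝕀(x; s_{k+1}…s_m; s_{m+1})`;
* (iv) `𝕀(a; s₁…s_m; a) = 0` for `m > 0`;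

with the coproduct given on generators by
`Δ 𝕀(a₀; a₁…a_m; a_{m+1}) = Σ_{0 = i₀ < i₁ < ⋯ < i_k < i_{k+1} = m+1}`
`𝕀(a₀; a_{i₁}…a_{i_k}; a_{m+1}) ⊗ ∏_{p=0}^{k} 𝕀(a_{i_p}; a_{i_p+1}…a_{i_{p+1}-1}; a_{i_{p+1}})`
and the counit killing `𝓘_{>0}(S)`; *Proposition 2.2*: `Δ` makes `𝓘_•(S)` (and the algebra
`𝓘̃_•(S)` without relations (ii)–(iv)) a commutative graded Hopf algebra (proved via *Theorem 2.5*,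
`𝓘_•(S) = 𝒪(G(S))` for the automorphism group scheme `G(S)` of the path algebra `P(S)`).

## What is here (a "Lean-light" but real construction)

* `Symbol S` — the symbols `𝕀(src; word; tgt)`; `SymbolAlgebra S = MvPolynomial (Symbol S) ℚ`,
  the free commutative `ℚ`-algebra on them, generators `gen a w b`; `Symbol.degree`.
* the four relation families `unitRel`, `shuffleRel` (via the tree's `MZV.shuffleWord`),
  `pathRel`, `loopRel`, their union `relators S` and the ideal `relIdeal S`;
* `GoncharovFormalIteratedIntegrals S := SymbolAlgebra S ⧸ relIdeal S` — the algebra `𝓘_•(S)`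
  (a `def` type synonym carrying the quotient `CommRing`/`Algebra ℚ` structure),
  with `mkQ`, the classes `ι a w b = [𝕀(a; w; b)]`, the relations as theorems (`ι_nil`, `ι_mul_ι`,
  `ι_eq_sum_take_drop`, `ι_self`), the first case `𝕀(a; c; b) = -𝕀(b; c; a)` of Prop. 2.1
  (`ι_singleton_eq_neg`), the universal property `lift`/`hom_ext`, and non-triviality;
* the coproduct on the free algebra as an EXPLICIT algebra map
  `coproductFree : SymbolAlgebra S →ₐ[ℚ] SymbolAlgebra S ⊗[ℚ] SymbolAlgebra S`, the subsets
  `{i₁ < ⋯ < i_k} ⊆ {1, …, m}` being enumerated as `splittings` of the word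
  (`w = g₀ ++ [k₁] ++ g₁ ++ ⋯ ++ [k_r] ++ g_r`: kept letters `k_j`, gaps `g_j`);
* the counit, PROVED to descend: `counit : 𝓘_•(S) →ₐ[ℚ] ℚ`;
* the NAMED FACT `coproduct_descends S` (the well-definedness half of Prop. 2.2: `Δ` respects
  (i)–(iv)), proved here for the families (i) and (iv) (`map_coproductFree_eq_zero_of_mem_unitRel`,
  `…_loopRel`); given `h : coproduct_descends S`, the coproduct
  `coproduct h : 𝓘 →ₐ[ℚ] 𝓘 ⊗[ℚ] 𝓘` and its value on generators (`coproduct_ι`);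
* `IsBiideal h J` — `ε(J) = 0` and `Δ(J) ⊆ J ⊗ 𝓘 + 𝓘 ⊗ J` (as `ker (π_J ⊗ π_J)`,
  cf. `Algebra.TensorProduct.map_ker`), the notion needed to say "`ker α` is a Hopf (co)ideal";
* Brown's comodule variant [Brown2012, §2.4, Thm 2.4]: `brownCoaction h K : 𝓘 →ₐ[ℚ] (𝓘 ⧸ K) ⊗[ℚ] 𝓘`,
  Goncharov's formula "with the factors interchanged" and the product factor reduced modulo an
  ideal `K` (Brown: `K = (ζᵐ(2))`, `A = H/K`), and `IsCoactionStable h K J` (`Δ_B(J) ⊆ A ⊗ J`).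

The specialisation `S = {0, 1}` (dictionary with `multipleZeta`/`MZV.binaryWord`, the regularised
quotient killing `𝕀(0;0;1)`, `𝕀(0;1;1)`, Brown's `K = (ζᵐ(2))`) is the sibling file
`GoncharovFormalIteratedIntegralsMZV.lean`.

## Deliberately NOT here

Coassociativity and the antipode (the remaining content of Prop. 2.2 / Thm. 2.5); the grading as
a `GradedAlgebra` structure (only the degree `Symbol.degree` is recorded — all four relation
families are homogeneous for it); Prop. 2.1 for `m ≥ 2`; the identification of `𝓘_•({0,1})`
with the shuffle algebra `(ℚ⟨ω₀, ω₁⟩, ш)`; any evaluation (period) map — `𝓘_•(S)` is formal.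

## References

* A. B. Goncharov, *Galois symmetries of fundamental groupoids and noncommutative geometry*,
  Duke Math. J. 128 (2005), 209–284, §2.1, Prop. 2.1, Prop. 2.2, Thm. 2.5 (arXiv:math/0208144).
  [Goncharov2005]
* F. Brown, *Mixed Tate motives over ℤ*, Ann. of Math. 175 (2012), 949–976, §2.1–2.4, Thm. 2.4
  (arXiv:1102.1312). [Brown2012]
-/

noncomputable section

open scoped TensorProduct

namespace Literature.NumberTheory.Transcendental

universe u

variable {S : Type u}

namespace GoncharovFormalIteratedIntegrals

/-! ### Symbols and the free algebra -/

/-- A symbol `𝕀(a₀; a₁, …, a_m; a_{m+1})` of a formal iterated integral over the set `S`: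
lower end point `src = a₀`, the word `word = (a₁, …, a_m)` of interior points IN GONCHAROV'S
ORDER (`a₁` sits at the smallest integration variable of
`∫_{a₀ ≤ t₁ ≤ ⋯ ≤ t_m ≤ a_{m+1}} dt₁/(t₁-a₁) ∧ ⋯ ∧ dt_m/(t_m-a_m)`), upper end point
`tgt = a_{m+1}`. [cite: Goncharov2005, §2.1] -/
@[ext]
structure Symbol (S : Type u) : Type u where
  /-- the lower end point `a₀` -/
  src : S
  /-- the interior points `a₁, …, a_m` -/
  word : List S
  /-- the upper end point `a_{m+1}` -/
  tgt : S

/-- The degree `m` of `𝕀(a₀; a₁, …, a_m; a_{m+1})` ("homogeneous of degree `m`").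
[cite: Goncharov2005, §2.1] -/
def Symbol.degree (s : Symbol S) : ℕ := s.word.length

variable (S) in
/-- The free commutative `ℚ`-algebra on the symbols `𝕀(a₀; …; a_{m+1})` (Goncharov's `𝓘̃_•(S)`
of §1.6, before any relation is imposed). [cite: Goncharov2005, §1.6] -/
abbrev SymbolAlgebra : Type u := MvPolynomial (Symbol S) ℚ

/-- The generator `𝕀(a; w; b)` of the free algebra. [cite: Goncharov2005, §2.1] -/
def gen (a : S) (w : List S) (b : S) : SymbolAlgebra S := MvPolynomial.X ⟨a, w, b⟩

/-- `gen` is the variable of the polynomial ring indexed by the symbol. [folklore] -/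
theorem X_eq_gen (s : Symbol S) : (MvPolynomial.X s : SymbolAlgebra S) = gen s.src s.word s.tgt := by
  cases s; rfl

/-! ### The relations (i)–(iv) -/

variable (S) in
/-- Relation (i), the unit: `𝕀(a; ∅; b) - 1`. [cite: Goncharov2005, §2.1 (i)] -/
def unitRel : Set (SymbolAlgebra S) := {r | ∃ a b : S, r = gen a [] b - 1}

variable (S) in
/-- Relation (ii), the shuffle product formula:
`𝕀(a; u; b) · 𝕀(a; v; b) - Σ_{w ∈ u ш v} 𝕀(a; w; b)`, the shuffles `u ш v` listed with
multiplicity by `MZV.shuffleWord`. [cite: Goncharov2005, §2.1 (ii)] -/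
def shuffleRel : Set (SymbolAlgebra S) :=
  {r | ∃ (a b : S) (u v : List S),
    r = gen a u b * gen a v b - ((MZV.shuffleWord u v).map fun w => gen a w b).sum}

variable (S) in
/-- Relation (iii), the path composition formula: for every `x ∈ S`,
`𝕀(a; s₁…s_m; b) - Σ_{k=0}^{m} 𝕀(a; s₁…s_k; x) · 𝕀(x; s_{k+1}…s_m; b)`.
[cite: Goncharov2005, §2.1 (iii)] -/
def pathRel : Set (SymbolAlgebra S) :=
  {r | ∃ (a b x : S) (w : List S),
    r = gen a w b - ∑ k ∈ Finset.range (w.length + 1), gen a (w.take k) x * gen x (w.drop k) b}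

variable (S) in
/-- Relation (iv): `𝕀(a; s₁…s_m; a)` for `m > 0`. [cite: Goncharov2005, §2.1 (iv)] -/
def loopRel : Set (SymbolAlgebra S) := {r | ∃ (a : S) (w : List S), w ≠ [] ∧ r = gen a w a}

variable (S) in
/-- All defining relators of `𝓘_•(S)`: the union of the families (i)–(iv).
[cite: Goncharov2005, §2.1] -/
def relators : Set (SymbolAlgebra S) := unitRel S ∪ shuffleRel S ∪ pathRel S ∪ loopRel S

variable (S) in
/-- The ideal of relations of `𝓘_•(S)`, generated by the relators (i)–(iv).
[cite: Goncharov2005, §2.1] -/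
def relIdeal : Ideal (SymbolAlgebra S) := Ideal.span (relators S)

/-- (i) is a relator. [cite: Goncharov2005, §2.1 (i)] -/
theorem unit_mem_relators (a b : S) : gen a [] b - 1 ∈ relators S :=
  Or.inl (Or.inl (Or.inl ⟨a, b, rfl⟩))

/-- (ii) is a relator. [cite: Goncharov2005, §2.1 (ii)] -/
theorem shuffle_mem_relators (a b : S) (u v : List S) :
    gen a u b * gen a v b - ((MZV.shuffleWord u v).map fun w => gen a w b).sum ∈ relators S :=
  Or.inl (Or.inl (Or.inr ⟨a, b, u, v, rfl⟩))

/-- (iii) is a relator. [cite: Goncharov2005, §2.1 (iii)] -/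
theorem path_mem_relators (a b x : S) (w : List S) :
    gen a w b - ∑ k ∈ Finset.range (w.length + 1), gen a (w.take k) x * gen x (w.drop k) b ∈
      relators S :=
  Or.inl (Or.inr ⟨a, b, x, w, rfl⟩)

/-- (iv) is a relator. [cite: Goncharov2005, §2.1 (iv)] -/
theorem loop_mem_relators (a : S) {w : List S} (hw : w ≠ []) : gen a w a ∈ relators S :=
  Or.inr ⟨a, w, hw, rfl⟩

end GoncharovFormalIteratedIntegrals

open GoncharovFormalIteratedIntegrals in
/-- **Goncharov's algebra `𝓘_•(S)` of formal iterated integrals** over the set `S`: the free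
commutative `ℚ`-algebra on the symbols `𝕀(a₀; a₁, …, a_m; a_{m+1})`, `aᵢ ∈ S`, modulo (i) unit,
(ii) shuffle product, (iii) path composition, (iv) `𝕀(a; w; a) = 0` (`w ≠ ∅`). Its Hopf structure:
`GoncharovFormalIteratedIntegrals.counit` (proved to descend) and
`GoncharovFormalIteratedIntegrals.coproduct` (under the named fact `coproduct_descends`).
[cite: Goncharov2005, §2.1] -/
def GoncharovFormalIteratedIntegrals (S : Type u) : Type u :=
  SymbolAlgebra S ⧸ relIdeal S

namespace GoncharovFormalIteratedIntegrals

/-- `𝓘_•(S)` is a commutative ring (quotient structure; the type is a `def` synonym of the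
quotient so that instance search does not unfold it). [folklore] -/
instance instCommRing : CommRing (GoncharovFormalIteratedIntegrals S) :=
  inferInstanceAs (CommRing (SymbolAlgebra S ⧸ relIdeal S))

/-- `𝓘_•(S)` is a `ℚ`-algebra (quotient structure). [folklore] -/
instance instAlgebra : Algebra ℚ (GoncharovFormalIteratedIntegrals S) :=
  inferInstanceAs (Algebra ℚ (SymbolAlgebra S ⧸ relIdeal S))

/-- `𝓘_•(S)` is inhabited (by `0`). [folklore] -/
instance instInhabited : Inhabited (GoncharovFormalIteratedIntegrals S) := ⟨0⟩

/-! ### Generators of the quotient and the relations as theorems -/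

/-- The quotient map `𝓘̃_•(S) → 𝓘_•(S)`. [cite: Goncharov2005, §2.1] -/
def mkQ : SymbolAlgebra S →ₐ[ℚ] GoncharovFormalIteratedIntegrals S :=
  Ideal.Quotient.mkₐ ℚ (relIdeal S)

/-- The class `ι a w b = [𝕀(a; w; b)] ∈ 𝓘_•(S)` of a symbol. [cite: Goncharov2005, §2.1] -/
def ι (a : S) (w : List S) (b : S) : GoncharovFormalIteratedIntegrals S := mkQ (gen a w b)

/-- `mkQ` is surjective. [folklore] -/
theorem mkQ_surjective : Function.Surjective (mkQ (S := S)) :=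
  Ideal.Quotient.mkₐ_surjective ℚ _

/-- Relators vanish in the quotient. [folklore] -/
theorem mkQ_eq_zero_of_mem {r : SymbolAlgebra S} (hr : r ∈ relators S) : mkQ r = 0 := by
  show (Ideal.Quotient.mkₐ ℚ (relIdeal S)) r = 0
  rw [Ideal.Quotient.mkₐ_eq_mk]
  exact Ideal.Quotient.eq_zero_iff_mem.mpr (Ideal.subset_span hr)

/-- (i) `𝕀(a; ∅; b) = 1`. [cite: Goncharov2005, §2.1 (i)] -/
@[simp] theorem ι_nil (a b : S) : ι a ([] : List S) b = 1 := by
  have h := mkQ_eq_zero_of_mem (unit_mem_relators a b)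
  rwa [map_sub, map_one, sub_eq_zero] at h

/-- (ii) the shuffle product formula `𝕀(a; u; b) 𝕀(a; v; b) = Σ_{w ∈ u ш v} 𝕀(a; w; b)`.
[cite: Goncharov2005, §2.1 (ii)] -/
theorem ι_mul_ι (a b : S) (u v : List S) :
    ι a u b * ι a v b = ((MZV.shuffleWord u v).map fun w => ι a w b).sum := by
  have h := mkQ_eq_zero_of_mem (shuffle_mem_relators a b u v)
  rw [map_sub, sub_eq_zero, map_mul, map_list_sum, List.map_map] at h
  exact h

/-- (iii) the path composition formula
`𝕀(a; w; b) = Σ_{k=0}^{|w|} 𝕀(a; w_{≤k}; x) 𝕀(x; w_{>k}; b)` for every `x`.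
[cite: Goncharov2005, §2.1 (iii)] -/
theorem ι_eq_sum_take_drop (a b x : S) (w : List S) :
    ι a w b = ∑ k ∈ Finset.range (w.length + 1), ι a (w.take k) x * ι x (w.drop k) b := by
  have h := mkQ_eq_zero_of_mem (path_mem_relators a b x w)
  rw [map_sub, sub_eq_zero, map_sum] at h
  simp_rw [map_mul] at h
  exact h

/-- (iv) `𝕀(a; w; a) = 0` for a non-empty word. [cite: Goncharov2005, §2.1 (iv)] -/
theorem ι_self (a : S) {w : List S} (hw : w ≠ []) : ι a w a = 0 :=
  mkQ_eq_zero_of_mem (loop_mem_relators a hw)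

/-- Proposition 2.1 in degree one: `𝕀(a; c; b) = -𝕀(b; c; a)` (path composition of
`𝕀(a; c; a) = 0` through `x = b`). [cite: Goncharov2005, Prop 2.1] -/
theorem ι_singleton_eq_neg (a c b : S) : ι a [c] b = -ι b [c] a := by
  have h := ι_eq_sum_take_drop a a b [c]
  rw [ι_self a (List.cons_ne_nil c [])] at h
  simp only [List.length_cons, List.length_nil, Finset.sum_range_succ, Finset.sum_range_zero,
    List.take_zero, List.drop_zero, List.take_succ_cons, List.take_nil, List.drop_succ_cons,
    List.drop_nil, ι_nil, one_mul, mul_one] at h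
  linear_combination -h

/-! ### Universal property -/

section lift

variable {A : Type*} [Semiring A] [Algebra ℚ A]

/-- An algebra map on the free algebra killing the relators kills the relation ideal.
[folklore] -/
theorem eq_zero_of_mem_relIdeal (f : SymbolAlgebra S →ₐ[ℚ] A) (hf : ∀ r ∈ relators S, f r = 0) :
    ∀ x ∈ relIdeal S, f x = 0 := by
  have hle : relIdeal S ≤ RingHom.ker f :=
    Ideal.span_le.mpr fun r hr => RingHom.mem_ker.mpr (hf r hr)
  exact fun x hx => RingHom.mem_ker.mp (hle hx)

/-- Universal property of `𝓘_•(S)`: an algebra map on symbols compatible with (i)–(iv) factors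
through `𝓘_•(S)`. [folklore] -/
def lift (f : SymbolAlgebra S →ₐ[ℚ] A) (hf : ∀ r ∈ relators S, f r = 0) :
    GoncharovFormalIteratedIntegrals S →ₐ[ℚ] A :=
  Ideal.Quotient.liftₐ (relIdeal S) f (eq_zero_of_mem_relIdeal f hf)

/-- `lift f` on a class. [folklore] -/
@[simp] theorem lift_mkQ (f : SymbolAlgebra S →ₐ[ℚ] A) (hf : ∀ r ∈ relators S, f r = 0)
    (x : SymbolAlgebra S) : lift f hf (mkQ x) = f x := rfl

/-- `lift f` on a generator. [folklore] -/
@[simp] theorem lift_ι (f : SymbolAlgebra S →ₐ[ℚ] A) (hf : ∀ r ∈ relators S, f r = 0)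
    (a : S) (w : List S) (b : S) : lift f hf (ι a w b) = f (gen a w b) := rfl

/-- Two algebra maps out of `𝓘_•(S)` that agree on the symbols are equal. [folklore] -/
theorem hom_ext {f g : GoncharovFormalIteratedIntegrals S →ₐ[ℚ] A}
    (hfg : ∀ (a : S) (w : List S) (b : S), f (ι a w b) = g (ι a w b)) : f = g :=
  Ideal.Quotient.algHom_ext ℚ (MvPolynomial.algHom_ext fun s => by
    cases s with
    | mk a w b => exact hfg a w b)

end lift

/-! ### The coproduct on the free algebra -/

/-- The splittings of a word: all `(g₀, [(k₁, g₁), …, (k_r, g_r)])` with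
`w = g₀ ++ [k₁] ++ g₁ ++ ⋯ ++ [k_r] ++ g_r` — the choice of the kept letters
`k_j = a_{i_j}`, `0 < i₁ < ⋯ < i_r < m+1`, in Goncharov's coproduct, together with the gaps
`g_j = (a_{i_j+1}, …, a_{i_{j+1}-1})` between consecutive kept letters (`2^{|w|}` splittings,
`length_splittings`). [cite: Goncharov2005, §2.1] -/
def splittings : List S → List (List S × List (S × List S))
  | [] => [([], [])]
  | c :: w =>
    ((splittings w).map fun p => (c :: p.1, p.2)) ++
      (splittings w).map fun p => (([] : List S), (c, p.1) :: p.2)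

/-- The right-hand factor `∏_{p=0}^{k} 𝕀(a_{i_p}; a_{i_p+1}, …, a_{i_{p+1}-1}; a_{i_{p+1}})` of
Goncharov's coproduct for a splitting: `gapProd x g₀ [(k₁,g₁),…,(k_r,g_r)] b =
𝕀(x; g₀; k₁) 𝕀(k₁; g₁; k₂) ⋯ 𝕀(k_r; g_r; b)`. [cite: Goncharov2005, §2.1] -/
def gapProd : S → List S → List (S × List S) → S → SymbolAlgebra S
  | x, g, [], b => gen x g b
  | x, g, p :: ps, b => gen x g p.1 * gapProd p.1 p.2 ps b

/-- Goncharov's coproduct on a generator: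
`Δ 𝕀(a₀; a₁…a_m; a_{m+1}) = Σ_{0=i₀<i₁<⋯<i_k<i_{k+1}=m+1} 𝕀(a₀; a_{i₁}…a_{i_k}; a_{m+1}) ⊗
∏_{p=0}^{k} 𝕀(a_{i_p}; a_{i_p+1}…a_{i_{p+1}-1}; a_{i_{p+1}})`, the index sets enumerated by
`splittings`. [cite: Goncharov2005, §2.1] -/
def coproductGen (s : Symbol S) : SymbolAlgebra S ⊗[ℚ] SymbolAlgebra S :=
  ((splittings s.word).map fun p =>
    gen s.src (p.2.map Prod.fst) s.tgt ⊗ₜ[ℚ] gapProd s.src p.1 p.2 s.tgt).sum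

variable (S) in
/-- Goncharov's coproduct `Δ` on the free algebra `𝓘̃_•(S)`, the algebra map extending
`coproductGen`. [cite: Goncharov2005, §2.1] -/
def coproductFree : SymbolAlgebra S →ₐ[ℚ] SymbolAlgebra S ⊗[ℚ] SymbolAlgebra S :=
  MvPolynomial.aeval coproductGen

/-- `Δ` on a generator is Goncharov's sum. [cite: Goncharov2005, §2.1] -/
theorem coproductFree_gen (a : S) (w : List S) (b : S) :
    coproductFree S (gen a w b) = ((splittings w).map fun p =>
      gen a (p.2.map Prod.fst) b ⊗ₜ[ℚ] gapProd a p.1 p.2 b).sum :=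
  MvPolynomial.aeval_X _ _

/-- Degree `0`: `Δ 𝕀(a; ∅; b) = 𝕀(a; ∅; b) ⊗ 𝕀(a; ∅; b)`. [cite: Goncharov2005, §2.1] -/
theorem coproductFree_gen_nil (a b : S) :
    coproductFree S (gen a [] b) = gen a [] b ⊗ₜ[ℚ] gen a [] b := by
  rw [coproductFree_gen]; simp [splittings, gapProd]

/-- Degree `1`: `Δ 𝕀(a; c; b) = 𝕀(a; ∅; b) ⊗ 𝕀(a; c; b) + 𝕀(a; c; b) ⊗ 𝕀(a; ∅; c) 𝕀(c; ∅; b)`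
(the terms `1 ⊗ 𝕀` and `𝕀 ⊗ 1` of §2.1 before (i) is used). [cite: Goncharov2005, §2.1] -/
theorem coproductFree_gen_singleton (a c b : S) :
    coproductFree S (gen a [c] b) =
      gen a [] b ⊗ₜ[ℚ] gen a [c] b + gen a [c] b ⊗ₜ[ℚ] (gen a [] c * gen c [] b) := by
  rw [coproductFree_gen]; simp [splittings, gapProd]

/-- A splitting reassembles the word: `g₀ ++ k₁ g₁ ++ ⋯ ++ k_r g_r = w`. [folklore] -/
theorem append_flatMap_eq_of_mem_splittings :
    ∀ (w : List S) {p : List S × List (S × List S)}, p ∈ splittings w →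
      p.1 ++ p.2.flatMap (fun q => q.1 :: q.2) = w
  | [], p, hp => by
    simp only [splittings, List.mem_singleton] at hp
    subst hp
    simp
  | c :: w, p, hp => by
    simp only [splittings, List.mem_append, List.mem_map] at hp
    rcases hp with ⟨q, hq, rfl⟩ | ⟨q, hq, rfl⟩
    · simpa using append_flatMap_eq_of_mem_splittings w hq
    · simpa using append_flatMap_eq_of_mem_splittings w hq

/-- There are `2^{|w|}` splittings (subsets of the interior letters). [folklore] -/
theorem length_splittings : ∀ w : List S, (splittings w).length = 2 ^ w.length
  | [] => rfl
  | c :: w => by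
    simp only [splittings, List.length_append, List.length_map, length_splittings w,
      List.length_cons, pow_succ]
    ring

/-! ### The counit (proved to descend) -/

/-- The indicator of the empty word (value of the counit on `𝕀(a; w; b)`). [folklore] -/
def emptyIndicator : List S → ℚ
  | [] => 1
  | _ :: _ => 0

/-- `emptyIndicator` vanishes on non-empty words. [folklore] -/
theorem emptyIndicator_of_ne_nil {w : List S} (hw : w ≠ []) : emptyIndicator w = 0 := by
  cases w with
  | nil => exact absurd rfl hw
  | cons _ _ => rfl

variable (S) in
/-- The counit on the free algebra: `𝕀(a; ∅; b) ↦ 1`, `𝕀(a; w; b) ↦ 0` for `w ≠ ∅` ("the counit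
is determined by the condition that it kills `𝓘_{>0}(S)`"). [cite: Goncharov2005, §2.1] -/
def counitFree : SymbolAlgebra S →ₐ[ℚ] ℚ := MvPolynomial.aeval fun s => emptyIndicator s.word

/-- The counit on a generator. [cite: Goncharov2005, §2.1] -/
@[simp] theorem counitFree_gen (a : S) (w : List S) (b : S) :
    counitFree S (gen a w b) = emptyIndicator w :=
  MvPolynomial.aeval_X _ _

/-- The counit kills every relator (i)–(iv). [folklore] -/
theorem counitFree_eq_zero_of_mem_relators : ∀ r ∈ relators S, counitFree S r = 0 := by
  rintro r (((⟨a, b, rfl⟩ | ⟨a, b, u, v, rfl⟩) | ⟨a, b, x, w, rfl⟩) | ⟨a, w, hw, rfl⟩)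
  · simp [emptyIndicator]
  · rw [map_sub, map_mul, map_list_sum, List.map_map, counitFree_gen, counitFree_gen, sub_eq_zero]
    by_cases huv : u = [] ∧ v = []
    · rcases huv with ⟨rfl, rfl⟩
      simp [emptyIndicator]
    · have h0 : emptyIndicator u * emptyIndicator v = 0 := by
        rcases not_and_or.mp huv with hu | hv
        · rw [emptyIndicator_of_ne_nil hu, zero_mul]
        · rw [emptyIndicator_of_ne_nil hv, mul_zero]
      rw [h0, eq_comm]
      refine List.sum_eq_zero fun q hq => ?_
      obtain ⟨w', hw', rfl⟩ := List.mem_map.mp hq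
      have hlen := MZV.length_of_mem_shuffleWord u v hw'
      have hpos : 0 < u.length + v.length := by
        rcases not_and_or.mp huv with hu | hv
        · have := List.length_pos_of_ne_nil hu; omega
        · have := List.length_pos_of_ne_nil hv; omega
      have hne : w' ≠ [] := by
        rintro rfl
        simp at hlen
        omega
      simpa using emptyIndicator_of_ne_nil hne
  · rw [map_sub, map_sum, sub_eq_zero, counitFree_gen]
    simp_rw [map_mul, counitFree_gen]
    cases w with
    | nil => simp [emptyIndicator]
    | cons c w =>
      rw [emptyIndicator_of_ne_nil (List.cons_ne_nil c w), eq_comm]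
      refine Finset.sum_eq_zero fun k _ => ?_
      cases k with
      | zero => simp [emptyIndicator]
      | succ k => simp [emptyIndicator]
  · rw [counitFree_gen, emptyIndicator_of_ne_nil hw]

variable (S) in
/-- **The counit** `ε : 𝓘_•(S) →ₐ[ℚ] ℚ` (kills `𝓘_{>0}(S)`), well defined by
`counitFree_eq_zero_of_mem_relators`. [cite: Goncharov2005, §2.1] -/
def counit : GoncharovFormalIteratedIntegrals S →ₐ[ℚ] ℚ :=
  lift (counitFree S) counitFree_eq_zero_of_mem_relators

/-- The counit on a symbol. [cite: Goncharov2005, §2.1] -/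
@[simp] theorem counit_ι (a : S) (w : List S) (b : S) : counit S (ι a w b) = emptyIndicator w := by
  rw [counit, lift_ι, counitFree_gen]

/-- `𝓘_•(S)` is not the zero ring (the counit is a character). [folklore] -/
instance : Nontrivial (GoncharovFormalIteratedIntegrals S) :=
  nontrivial_of_ne 0 1 fun h01 => by
    have h := congrArg (counit S) h01
    rw [map_zero, map_one] at h
    exact zero_ne_one h

/-! ### The coproduct on `𝓘_•(S)` -/

variable (S) in
/-- **Named fact (Goncharov 2005, Prop. 2.2 — well-definedness of `Δ`).** "The coproduct `Δ`
provides `𝓘_•(S)` … with the structure of a commutative, graded Hopf algebra"; in particular the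
algebra map `Δ` defined on generators by Goncharov's formula respects the relations (i)–(iv):
every relator is killed by `𝓘̃ ⊗ 𝓘̃ → 𝓘 ⊗ 𝓘 ∘ Δ`. Proved below for the families (i) and (iv);
(ii) and (iii) are the combinatorial heart (Goncharov proves them through `𝓘_•(S) = 𝒪(G(S))`,
Thm. 2.5). Coassociativity is not part of this statement. [cite: Goncharov2005, Prop 2.2] -/
def coproduct_descends : Prop :=
  ∀ r ∈ relators S, Algebra.TensorProduct.map (mkQ (S := S)) (mkQ (S := S)) (coproductFree S r) = 0

/-- `Δ` respects relation (i): `Δ(𝕀(a;∅;b) - 1) ↦ 1 ⊗ 1 - 1 = 0`. [folklore] -/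
theorem map_coproductFree_eq_zero_of_mem_unitRel {r : SymbolAlgebra S} (hr : r ∈ unitRel S) :
    Algebra.TensorProduct.map (mkQ (S := S)) (mkQ (S := S)) (coproductFree S r) = 0 := by
  obtain ⟨a, b, rfl⟩ := hr
  rw [map_sub, map_one, coproductFree_gen_nil, map_sub, map_one, Algebra.TensorProduct.map_tmul,
    sub_eq_zero, Algebra.TensorProduct.one_def]
  change ι a [] b ⊗ₜ[ℚ] ι a [] b = 1 ⊗ₜ[ℚ] 1
  rw [ι_nil]

/-- `Δ` respects relation (iv): in each term of `Δ 𝕀(a; w; a)` either the left factor is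
`𝕀(a; a_{i₁}…a_{i_k}; a)` with `k ≥ 1`, or (`k = 0`) the right factor is `𝕀(a; w; a)` itself.
[folklore] -/
theorem map_coproductFree_eq_zero_of_mem_loopRel {r : SymbolAlgebra S} (hr : r ∈ loopRel S) :
    Algebra.TensorProduct.map (mkQ (S := S)) (mkQ (S := S)) (coproductFree S r) = 0 := by
  obtain ⟨a, w, hw, rfl⟩ := hr
  rw [coproductFree_gen, map_list_sum, List.map_map]
  refine List.sum_eq_zero fun t ht => ?_
  obtain ⟨p, hp, rfl⟩ := List.mem_map.mp ht
  simp only [Function.comp_apply, Algebra.TensorProduct.map_tmul]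
  rcases hks : p.2 with _ | ⟨q, qs⟩
  · have hflat := append_flatMap_eq_of_mem_splittings w hp
    rw [hks, List.flatMap_nil, List.append_nil] at hflat
    subst hflat
    change ι a _ a ⊗ₜ[ℚ] ι a p.1 a = 0
    rw [ι_self a hw, TensorProduct.tmul_zero]
  · change ι a _ a ⊗ₜ[ℚ] mkQ _ = 0
    rw [ι_self a (by simp), TensorProduct.zero_tmul]

/-- **Goncharov's coproduct** `Δ : 𝓘_•(S) →ₐ[ℚ] 𝓘_•(S) ⊗[ℚ] 𝓘_•(S)`, given the descent fact.
[cite: Goncharov2005, §2.1, Prop 2.2] -/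
def coproduct (h : coproduct_descends S) :
    GoncharovFormalIteratedIntegrals S →ₐ[ℚ]
      GoncharovFormalIteratedIntegrals S ⊗[ℚ] GoncharovFormalIteratedIntegrals S :=
  lift ((Algebra.TensorProduct.map mkQ mkQ).comp (coproductFree S)) h

/-- `Δ` on a symbol: Goncharov's formula in `𝓘 ⊗ 𝓘`. [cite: Goncharov2005, §2.1] -/
theorem coproduct_ι (h : coproduct_descends S) (a : S) (w : List S) (b : S) :
    coproduct h (ι a w b) = ((splittings w).map fun p =>
      ι a (p.2.map Prod.fst) b ⊗ₜ[ℚ] mkQ (gapProd a p.1 p.2 b)).sum := by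
  rw [coproduct, lift_ι, AlgHom.comp_apply, coproductFree_gen, map_list_sum, List.map_map]
  rfl

/-- `Δ 𝕀(a; ∅; b) = 1 ⊗ 1`. [cite: Goncharov2005, §2.1] -/
theorem coproduct_ι_nil (h : coproduct_descends S) (a b : S) : coproduct h (ι a [] b) = 1 := by
  rw [ι_nil]
  exact map_one (coproduct h)

/-- Degree-one symbols are primitive: `Δ 𝕀(a; c; b) = 1 ⊗ 𝕀(a; c; b) + 𝕀(a; c; b) ⊗ 1`.
[cite: Goncharov2005, §2.1] -/
theorem coproduct_ι_singleton (h : coproduct_descends S) (a c b : S) :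
    coproduct h (ι a [c] b) = 1 ⊗ₜ[ℚ] ι a [c] b + ι a [c] b ⊗ₜ[ℚ] 1 := by
  rw [coproduct, lift_ι, AlgHom.comp_apply, coproductFree_gen_singleton, map_add,
    Algebra.TensorProduct.map_tmul, Algebra.TensorProduct.map_tmul, map_mul]
  change ι a [] b ⊗ₜ[ℚ] ι a [c] b + ι a [c] b ⊗ₜ[ℚ] (ι a [] c * ι c [] b) = _
  rw [ι_nil, ι_nil, ι_nil, mul_one]

/-! ### Bi-ideals (Hopf ideals) and Brown's comodule variant -/

/-- A **bi-ideal** of `𝓘_•(S)` (for a commutative Hopf algebra over a field the same as a Hopf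
ideal): an ideal `J` with `ε(J) = 0` and `Δ(J) ⊆ J ⊗ 𝓘 + 𝓘 ⊗ J`, the latter written as
`Δ(J) ⊆ ker (π_J ⊗ π_J)` (equal to `J ⊗ 𝓘 + 𝓘 ⊗ J` by `Algebra.TensorProduct.map_ker`). Then
`𝓘/J` inherits `Δ` and `ε`. [folklore] -/
def IsBiideal (h : coproduct_descends S) (J : Ideal (GoncharovFormalIteratedIntegrals S)) : Prop :=
  (∀ x ∈ J, counit S x = 0) ∧
    ∀ x ∈ J, Algebra.TensorProduct.map (Ideal.Quotient.mkₐ ℚ J) (Ideal.Quotient.mkₐ ℚ J)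
      (coproduct h x) = 0

/-- The kernel of `π_J ⊗ π_J` on `𝓘 ⊗ 𝓘` is `J ⊗ 𝓘 + 𝓘 ⊗ J`. [folklore] -/
theorem map_mkₐ_eq_zero_iff (J : Ideal (GoncharovFormalIteratedIntegrals S))
    (y : GoncharovFormalIteratedIntegrals S ⊗[ℚ] GoncharovFormalIteratedIntegrals S) :
    Algebra.TensorProduct.map (Ideal.Quotient.mkₐ ℚ J) (Ideal.Quotient.mkₐ ℚ J) y = 0 ↔
      y ∈ J.map (Algebra.TensorProduct.includeLeft :
          GoncharovFormalIteratedIntegrals S →ₐ[ℚ] _ ⊗[ℚ] _) ⊔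
        J.map (Algebra.TensorProduct.includeRight :
          GoncharovFormalIteratedIntegrals S →ₐ[ℚ] _ ⊗[ℚ] _) := by
  have hk : RingHom.ker (Ideal.Quotient.mkₐ ℚ J) = J := by
    ext x
    rw [RingHom.mem_ker, Ideal.Quotient.mkₐ_eq_mk]
    exact Ideal.Quotient.eq_zero_iff_mem
  rw [← RingHom.mem_ker, Algebra.TensorProduct.map_ker _ _ (Ideal.Quotient.mkₐ_surjective ℚ J)
    (Ideal.Quotient.mkₐ_surjective ℚ J), hk]

/-- **Brown's coaction** built from Goncharov's coproduct: "given by the same formula … with the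
factors interchanged", the (now left) product factor reduced modulo an ideal `K`
(Brown: `𝓐 = 𝓗/(ζᵐ(2))`, `Δ : 𝓗 → 𝓐 ⊗ 𝓗`). Purely combinatorial transport of
[Brown2012, Thm 2.4] to the formal algebra. [cite: Brown2012, §2.4 Thm 2.4] -/
def brownCoaction (h : coproduct_descends S) (K : Ideal (GoncharovFormalIteratedIntegrals S)) :
    GoncharovFormalIteratedIntegrals S →ₐ[ℚ]
      (GoncharovFormalIteratedIntegrals S ⧸ K) ⊗[ℚ] GoncharovFormalIteratedIntegrals S :=
  AlgHom.comp
    (Algebra.TensorProduct.map (Ideal.Quotient.mkₐ ℚ K)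
      (AlgHom.id ℚ (GoncharovFormalIteratedIntegrals S)))
    (AlgHom.comp
      (Algebra.TensorProduct.comm ℚ (GoncharovFormalIteratedIntegrals S)
        (GoncharovFormalIteratedIntegrals S)).toAlgHom
      (coproduct h))

/-- Brown's coaction on a symbol:
`Σ π(∏_p 𝕀(a_{i_p}; …; a_{i_{p+1}})) ⊗ 𝕀(a₀; a_{i₁}…a_{i_k}; a_{m+1})`.
[cite: Brown2012, §2.4 Thm 2.4] -/
theorem brownCoaction_ι (h : coproduct_descends S) (K : Ideal (GoncharovFormalIteratedIntegrals S))
    (a : S) (w : List S) (b : S) :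
    brownCoaction h K (ι a w b) = ((splittings w).map fun p =>
      Ideal.Quotient.mkₐ ℚ K (mkQ (gapProd a p.1 p.2 b)) ⊗ₜ[ℚ] ι a (p.2.map Prod.fst) b).sum := by
  simp only [brownCoaction, AlgHom.comp_apply, coproduct_ι, map_list_sum, List.map_map]
  rfl

/-- `J` is stable under Brown's coaction over `A = 𝓘/K`: `Δ_B(J) ⊆ A ⊗ J`, i.e. `J` is a
sub-comodule (written as `Δ_B(J) ⊆ ker (id ⊗ π_J)`). [cite: Brown2012, §2.2] -/
def IsCoactionStable (h : coproduct_descends S)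
    (K J : Ideal (GoncharovFormalIteratedIntegrals S)) : Prop :=
  ∀ x ∈ J, Algebra.TensorProduct.map (AlgHom.id ℚ (GoncharovFormalIteratedIntegrals S ⧸ K))
    (Ideal.Quotient.mkₐ ℚ J) (brownCoaction h K x) = 0

end GoncharovFormalIteratedIntegrals

end Literature.NumberTheory.Transcendental
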